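import Mathlib
import Summits.Ventures.PercRepro.PuncturedLYMMixT3Q3Table1
import Summits.Ventures.PercRepro.PuncturedLYMMixT3Q3Table2

/-!
# PercRepro — (SP) FOR `3` PAIRWISE DISJOINT TRIPLES AND `3` PAIRWISE DISJOINT QUADRUPLES AT LEVEL `4`: POSITIVITY OF THE DENOMINATORS (1)
(p10, gen 41)

`den > 0`, `Pc > 0` for `n ≥ 21`; `Yc > 0` for `n ≥ 5`.  Nothing here asserts (SP).
-/

namespace PercRepro.PuncturedLYM.Split.TypeLift.MixT3Q3

/-- `den > 0` for `n ≥ 21`. -/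
theorem den_pos (n : ℚ) (hn : 21 ≤ n) : 0 < den n := by
  obtain ⟨n', hn', rfl⟩ : ∃ n', 0 ≤ n' ∧ n = 21 + n' := ⟨n - 21, by linarith, by ring⟩
  have h : den (21 + n') = 746496 * n' ^ 19 + 272595456 * n' ^ 18 + 47137868352 * n' ^ 17 + 5130625447872 * n' ^ 16 + 394057458766944 * n' ^ 15 + 22691297101866912 * n' ^ 14 + 1015913360805669252 * n' ^ 13 + 36187405601012772084 * n' ^ 12 + 1040715415176246100212 * n' ^ 11 + 24377336100140810349780 * n' ^ 10 + 466986348038170505664636 * n' ^ 9 + 7316088199187902997164764 * n' ^ 8 + 93349668819310378811057340 * n' ^ 7 + 961581360899382422766965724 * n' ^ 6 + 7879789728563851153133862000 * n' ^ 5 + 50197141909524904038257641056 * n' ^ 4 + 239705701031731170626000953920 * n' ^ 3 + 807564833268676455924836314560 * n' ^ 2 + 1712074278052048506353343104256 * n' + 1718349436193651261933570187264 := by unfold den; ring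
  rw [h]; positivity

/-- `Yc > 0` for `n ≥ 5`. -/
theorem Yc_pos (n : ℚ) (hn : 5 ≤ n) : 0 < Yc n := by
  obtain ⟨n', hn', rfl⟩ : ∃ n', 0 ≤ n' ∧ n = 5 + n' := ⟨n - 5, by linarith, by ring⟩
  have h : Yc (5 + n') = (1 / 120) * n' ^ 5 + (1 / 8) * n' ^ 4 + (17 / 24) * n' ^ 3 + (15 / 8) * n' ^ 2 + (137 / 60) * n' + 1 := by unfold Yc; ring
  rw [h]; positivity

/-- `Pc > 0` for `n ≥ 21`. -/
theorem Pc_pos (n : ℚ) (hn : 21 ≤ n) : 0 < Pc n := by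
  obtain ⟨n', hn', rfl⟩ : ∃ n', 0 ≤ n' ∧ n = 21 + n' := ⟨n - 21, by linarith, by ring⟩
  have h : Pc (21 + n') = (1 / 24) * n' ^ 4 + (13 / 4) * n' ^ 3 + (2279 / 24) * n' ^ 2 + (4915 / 4) * n' + 5928 := by unfold Pc; ring
  rw [h]; positivity

end PercRepro.PuncturedLYM.Split.TypeLift.MixT3Q3
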